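import Literature.Analysis.FluidPDE.KNSSTypeIRateCore
import Literature.Analysis.FluidPDE.OseenKernelLineIntegrals
import Literature.Analysis.UnboundedOperators.HeatExtensionDecay
import HarnessLib

/-!
# KNSS 2009, proof of Theorem 6.2, the Liouville step cut into its two printed halves

Analysis/FluidPDE file (one named fact, the rest proved), third layer of the decomposition of
`Literature.Analysis.FluidPDE.KNSS2009_regularity_typeI_rate` (Koch–Nadirashvili–Seregin–Šverák,
Acta Math. 203 (2009) = arXiv:0709.3599, Theorem 6.2), below the named fact
`Literature.Analysis.FluidPDE.KNSS2009_typeI_rate_liouville` (`KNSSTypeIRateCore`, ingredient 2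
of Steps 5–6 of the printed proof, arXiv p. 13):

> "In view of (wkbound) we have `|w| ≤ 2` in `ℝ³ × (−∞, 0)`. Moreover, since the solutions
> `v⁽ᵏ⁾` are axi-symmetric and `M_k ↗ ∞`, it is easy to see that `w` is independent of the
> `x₂`-variable. Applying Theorem 5.1 and Remark 6.1 to the field `(w₁, w₃)`, we conclude that
> `(w₁, w₃)` must vanish identically, and this easily implies that `w = 0` in `ℝ³ × (−∞, 0)`."

The sentence has two halves of very different weight, over the data of
`KNSS2009_typeI_rate_liouville` (a field `W : ℝ → ℝ³ → ℝ³` jointly continuous and bounded on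
`(−∞, 0) × ℝ³`, with weakly divergence-free slices, satisfying the Oseen integral equation
`W(t) = e^{(t−s)Δ} W(s) − B¹_s(W, W)(t)` pointwise for all `s < t < 0`, independent of `x₂` —
Lean coordinate `1` — and with `√(−t)‖W(t, x)‖ ≤ C`):

1. `KNSS2009_typeI_rate_liouville_horizontal` (**named fact**) — the planar part vanishes,
   `W₀ = W₂ = 0` (paper: `(w₁, w₃) = 0`). This is where Theorem 5.1 (the planar Liouville
   theorem, named fact `KNSS2009_liouville_planar` of `KNSSLiouville`, itself reduced in
   `KNSSLiouvillePlanar` to the §4 regularity fact `KNSS2009_regularity_boundedWeak_ancient_planar`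
   and the proved Lemma 2.1) and Remark 6.1 enter: the planar part of `W`, read on the plane
   `x₁ = 0`, is a bounded weak solution in `ℝ² × (−∞, 0)` (an Oseen-mild solution is a
   duality-form mild solution — `integral_inner_oseenDuhamel_eq_neg_intervalIntegral`,
   `NSBoundedMildOseenDuhamel` — hence a bounded weak solution —
   `IsBoundedAncientMildSolution.isBoundedWeakNSSolutionOn`, `AncientMildWeak` —, and bounded weak
   solutions independent of one variable descend to the plane), so `(W₀, W₂)(t, ·) = β(t)` a.e.
   for a.e. `t` by Theorem 5.1, everywhere by continuity; the planar components of the Duhamel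
   term `B¹_s(W, W)(t)` of a field `β(τ) + W₁(τ, x)e₁` with `β ⊥ e₁` constant in space and `W₁`
   independent of `x₁` vanish (`OseenKernelLineIntegrals`:
   `inner_integral_oseenKernel_sub_smul_single_right`, `integral_oseenKernel_sub_smul_single_left`,
   and `∫ K(τ, x − y)[β, β] dy = 0`), so `β(t) = e^{(t−s)Δ}β(s) = β(s)` — Remark 6.1 for this
   field — and `√(−t)‖β‖ ≤ C` forces `β = 0`. The discharge down to `KNSS2009_liouville_planar`
   is the object of the sibling files of this unit.
2. `KNSS2009_typeI_rate_liouville_axial` (**proved here**) — "this easily implies that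
   `w = 0`": if `W₀ = W₂ = 0` then `W = 0`. Indeed `W = W₁e₁` with `W₁` independent of `x₁`,
   so the Duhamel term `B¹_s(W, W)(t) = ∫∫ K(t−τ, x−y)[W₁e₁, W₁e₁] dy dτ` vanishes
   (`integral_oseenKernel_sub_smul_single_left`: the fibre integral
   `∫ K(σ, z' + re₁)[e₁, b] dr` is zero — formally, `∇·(W ⊗ W) = ∂₁(W₁²)e₁ = 0`),
   `W(t) = e^{(t−s)Δ}W(s)` for every `s < t`, and `‖W(t, x)‖ ≤ sup ‖W(s)‖ ≤ C/√(−s) → 0` as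
   `s → −∞` (`UnboundedOperators.norm_heatExtension_le_of_bound`). The divergence constraint is
   not needed.

`KNSS2009_typeI_rate_liouville_of_horizontal : horizontal → KNSS2009_typeI_rate_liouville` is
the glue (proved).

## References

* G. Koch, N. Nadirashvili, G. Seregin, V. Šverák, *Liouville theorems for the Navier–Stokes
  equations and applications*, Acta Math. 203 (2009) 83–105 = arXiv:0709.3599 (arXiv pages):
  proof of Theorem 6.2, p. 13 (the quoted sentence); Theorem 5.1, p. 9; Remark 6.1, p. 11;
  §3 p. 6 and §4 (i) p. 8 (mild solutions = the representation formula).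
  [KochNadirashviliSereginSverak2009]
-/

noncomputable section

open MeasureTheory Set Function Filter
open _root_.Topology

namespace Literature.Analysis.FluidPDE

/-! ### Half 1: the planar part vanishes (Theorem 5.1 with Remark 6.1) — named fact -/

/-- **KNSS 2009, proof of Theorem 6.2, Liouville step, first half: the planar part of the
blow-up limit vanishes** (Acta Math. 203 (2009) = arXiv:0709.3599, p. 13: "Applying Theorem 5.1
and Remark 6.1 to the field `(w₁, w₃)`, we conclude that `(w₁, w₃)` must vanish identically";
Theorem 5.1, p. 9: a bounded weak solution in `ℝ² × (−∞, 0)` is of the form `b(t)`; Remark 6.1,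
p. 11: a bounded ancient mild solution of the form `b(t)` is constant). **Statement.** Let
`W : ℝ → ℝ³ → ℝ³` be jointly continuous on `(−∞, 0) × ℝ³`, bounded there, with weakly
divergence-free slices, satisfying the Oseen integral equation
`W(t) = e^{(t−s)Δ} W(s) − B¹_s(W, W)(t)` pointwise for all `s < t < 0` (KNSS's mild solutions,
§3 p. 6 and §4 (i) p. 8, in the tree's rendering `UnboundedOperators.heatExtension`,
`oseenDuhamel`), independent of `x₂` (Lean coordinate `1`: `W(t, x + δe₁) = W(t, x)`), and with
`√(−t)‖W(t, x)‖ ≤ C`. Then the planar components vanish: `W(t, x)₀ = W(t, x)₂ = 0` for all `t < 0`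
and all `x` (paper indices `1, 3`). Route of the discharge (module docstring): Oseen-mild ⇒
duality-form mild ⇒ bounded weak on `ℝ³`; descent to `ℝ²` along the ignorable coordinate;
Theorem 5.1 = `KNSS2009_liouville_planar`; continuity; Remark 6.1 for the field
`β(t) + W₁e₁` through the line integrals of `oseenKernel` (`OseenKernelLineIntegrals`); the
decay kills the constant. Users take `(h : KNSS2009_typeI_rate_liouville_horizontal)`. [cite: KochNadirashviliSereginSverak2009, proof of Thm 6.2 (arXiv p. 13) with Thm 5.1 (p. 9) and Remark 6.1 (p. 11)] -/
def KNSS2009_typeI_rate_liouville_horizontal : Prop :=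
  ∀ ⦃C : ℝ⦄ ⦃W : ℝ → EuclideanSpace ℝ (Fin 3) → EuclideanSpace ℝ (Fin 3)⦄,
    ContinuousOn (uncurry W) (Iio 0 ×ˢ univ) →
    (∃ K : ℝ, ∀ t < 0, ∀ x, ‖W t x‖ ≤ K) →
    (∀ t < 0, IsWeaklyDivFree (W t)) →
    (∀ s t : ℝ, s < t → t < 0 → ∀ x,
      W t x = UnboundedOperators.heatExtension (W s) (t - s) x - oseenDuhamel 1 s W W t x) →
    (∀ t < 0, ∀ (x : EuclideanSpace ℝ (Fin 3)) (δ : ℝ), W t (x + EuclideanSpace.single 1 δ) = W t x) →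
    (∀ t < 0, ∀ x, Real.sqrt (-t) * ‖W t x‖ ≤ C) →
    ∀ t < 0, ∀ x, W t x 0 = 0 ∧ W t x 2 = 0

/-! ### Half 2: "this easily implies that `w = 0`" — proved -/

/-- **A vector is zero if `√(−s)‖v‖ ≤ C` for all `s` below some `t ≤ 0`** (let `s → −∞`:
with `s = t − (C/‖v‖)² − 1` one gets `√(−s)‖v‖ > |C|`). [folklore] -/
theorem eq_zero_of_forall_sqrt_neg_mul_norm_le {F : Type*} [NormedAddCommGroup F] {v : F}
    {t C : ℝ} (h : ∀ s < t, Real.sqrt (-s) * ‖v‖ ≤ C) (ht : t ≤ 0) : v = 0 := by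
  by_contra hv
  have hn : 0 < ‖v‖ := norm_pos_iff.2 hv
  set s : ℝ := t - (C / ‖v‖) ^ 2 - 1 with hs
  have hst : s < t := by rw [hs]; nlinarith [sq_nonneg (C / ‖v‖)]
  have hneg : (C / ‖v‖) ^ 2 < -s := by rw [hs]; linarith
  have h1 : |C| / ‖v‖ < Real.sqrt (-s) := by
    rw [← abs_of_pos hn, ← abs_div, ← Real.sqrt_sq_eq_abs]
    exact Real.sqrt_lt_sqrt (sq_nonneg _) hneg
  have h2 : |C| < Real.sqrt (-s) * ‖v‖ := by
    rw [div_lt_iff₀ hn] at h1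
    exact h1
  linarith [h s hst, le_abs_self C]

/-- **KNSS 2009, proof of Theorem 6.2, Liouville step, second half: the axial component
follows** (Acta Math. 203 (2009) = arXiv:0709.3599, p. 13: "… `(w₁, w₃)` must vanish
identically, and this easily implies that `w = 0` in `ℝ³ × (−∞, 0)`"). Let
`W : ℝ → ℝ³ → ℝ³` be jointly continuous on `(−∞, 0) × ℝ³`, bounded there, satisfying the Oseen
integral equation `W(t) = e^{(t−s)Δ} W(s) − B¹_s(W, W)(t)` pointwise for all `s < t < 0`,
independent of `x₂` (Lean coordinate `1`), with `√(−t)‖W(t, x)‖ ≤ C`, and suppose its planar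
components vanish, `W(t, x)₀ = W(t, x)₂ = 0`. Then `W = 0` on `(−∞, 0) × ℝ³`. Proof: `W = W₁e₁`
with `W₁` continuous, bounded and independent of `x₁`, so the inner integral of the Duhamel term,
`∫ K(t − τ, x − y)[W₁e₁, W₁e₁] dy`, vanishes for every `τ`
(`integral_oseenKernel_sub_smul_single_left`), whence `W(t) = e^{(t−s)Δ}W(s)` and
`‖W(t, x)‖ ≤ C/√(−s)` for every `s < t` (`norm_heatExtension_le_of_bound`), and `s → −∞`
(`eq_zero_of_forall_sqrt_neg_mul_norm_le`). The divergence constraint is not needed and not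
assumed. [cite: KochNadirashviliSereginSverak2009, proof of Thm 6.2 (arXiv p. 13)] -/
theorem KNSS2009_typeI_rate_liouville_axial {C : ℝ}
    {W : ℝ → EuclideanSpace ℝ (Fin 3) → EuclideanSpace ℝ (Fin 3)}
    (hcont : ContinuousOn (uncurry W) (Iio 0 ×ˢ univ))
    (hbdd : ∃ K : ℝ, ∀ t < 0, ∀ x, ‖W t x‖ ≤ K)
    (hmild : ∀ s t : ℝ, s < t → t < 0 → ∀ x,
      W t x = UnboundedOperators.heatExtension (W s) (t - s) x - oseenDuhamel 1 s W W t x)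
    (hinv : ∀ t < 0, ∀ (x : EuclideanSpace ℝ (Fin 3)) (δ : ℝ),
      W t (x + EuclideanSpace.single 1 δ) = W t x)
    (hdecay : ∀ t < 0, ∀ x, Real.sqrt (-t) * ‖W t x‖ ≤ C)
    (hhor : ∀ t < 0, ∀ x, W t x 0 = 0 ∧ W t x 2 = 0) :
    ∀ t < 0, ∀ x, W t x = 0 := by
  obtain ⟨K, hK⟩ := hbdd
  -- slices are continuous
  have hWc : ∀ τ < 0, Continuous (W τ) := fun τ hτ =>
    hcont.comp_continuous (f := fun x : EuclideanSpace ℝ (Fin 3) => (τ, x)) (by fun_prop)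
      fun x => ⟨hτ, mem_univ _⟩
  -- the field is axial: `W = W₁ e₁`
  have hax : ∀ τ < 0, ∀ y, W τ y = W τ y 1 • EuclideanSpace.single (1 : Fin 3) (1 : ℝ) := by
    intro τ hτ y
    obtain ⟨h0, h2⟩ := hhor τ hτ y
    ext j
    fin_cases j <;> simp [h0, h2]
  -- the Duhamel term vanishes
  have hD : ∀ s t : ℝ, s < t → t < 0 → ∀ x, oseenDuhamel 1 s W W t x = 0 := by
    intro s t hst ht x
    rw [oseenDuhamel_apply]
    refine setIntegral_eq_zero_of_forall_eq_zero fun τ hτ => ?_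
    have hτ0 : τ < 0 := hτ.2.trans ht
    have hσ : 0 < 1 * (t - τ) := by rw [one_mul]; exact sub_pos.2 hτ.2
    have heq : (fun y => oseenKernel (1 * (t - τ)) (x - y) (W τ y) (W τ y)) =
        fun y => oseenKernel (1 * (t - τ)) (x - y)
          (W τ y 1 • EuclideanSpace.single (1 : Fin 3) (1 : ℝ))
          (W τ y 1 • EuclideanSpace.single (1 : Fin 3) (1 : ℝ)) :=
      funext fun y => by rw [← hax τ hτ0 y]
    rw [heq]
    have hgc : Continuous fun y : EuclideanSpace ℝ (Fin 3) => W τ y 1 :=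
      (PiLp.continuous_apply 2 _ 1).comp (hWc τ hτ0)
    have hb1 : ∀ y, |W τ y 1| ≤ K := fun y =>
      (Real.norm_eq_abs _ ▸ PiLp.norm_apply_le (W τ y) 1).trans (hK τ hτ0 y)
    have hb2 : ∀ y, ‖W τ y 1 • EuclideanSpace.single (1 : Fin 3) (1 : ℝ)‖ ≤ K := fun y => by
      rw [← hax τ hτ0 y]; exact hK τ hτ0 y
    have hi1 : ∀ (y : EuclideanSpace ℝ (Fin 3)) (δ : ℝ),
        W τ (y + EuclideanSpace.single 1 δ) 1 = W τ y 1 :=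
      fun y δ => by rw [hinv τ hτ0 y δ]
    have hi2 : ∀ (y : EuclideanSpace ℝ (Fin 3)) (δ : ℝ),
        W τ (y + EuclideanSpace.single 1 δ) 1 • EuclideanSpace.single (1 : Fin 3) (1 : ℝ) =
          W τ y 1 • EuclideanSpace.single (1 : Fin 3) (1 : ℝ) :=
      fun y δ => by rw [hinv τ hτ0 y δ]
    exact integral_oseenKernel_sub_smul_single_left hσ (g := fun y => W τ y 1)
      (c := fun y => W τ y 1 • EuclideanSpace.single (1 : Fin 3) (1 : ℝ)) hgc.aestronglyMeasurable
      (hgc.smul continuous_const).aestronglyMeasurable hb1 hb2 hi1 hi2 x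
  -- the caloric bound and the limit `s → −∞`
  intro t ht x
  refine eq_zero_of_forall_sqrt_neg_mul_norm_le (t := t) (C := C) (fun s hst => ?_) ht.le
  have hs0 : s < 0 := hst.trans ht
  have hsq : 0 < Real.sqrt (-s) := Real.sqrt_pos.2 (by linarith)
  have hbound : ∀ z, ‖W s z‖ ≤ C / Real.sqrt (-s) := fun z => by
    rw [le_div_iff₀ hsq, mul_comm]; exact hdecay s hs0 z
  have h1 : ‖W t x‖ ≤ C / Real.sqrt (-s) := by
    rw [hmild s t hst ht x, hD s t hst ht x, sub_zero]
    exact UnboundedOperators.norm_heatExtension_le_of_bound hbound (sub_pos.2 hst) x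
  rw [mul_comm, ← le_div_iff₀ hsq]
  exact h1

/-! ### The glue -/

/-- **The Liouville step of the proof of KNSS Theorem 6.2 from its first half**: once the planar
part vanishes (`KNSS2009_typeI_rate_liouville_horizontal`, Theorem 5.1 with Remark 6.1), so does
the axial component (`KNSS2009_typeI_rate_liouville_axial`, proved), which is the named fact
`KNSS2009_typeI_rate_liouville` of `KNSSTypeIRateCore`. [cite: KochNadirashviliSereginSverak2009, proof of Thm 6.2 (arXiv p. 13)] -/
theorem KNSS2009_typeI_rate_liouville_of_horizontal (h₁ : KNSS2009_typeI_rate_liouville_horizontal) :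
    KNSS2009_typeI_rate_liouville :=
  fun _C _W hcont hbdd hdiv hmild hinv hdecay =>
    KNSS2009_typeI_rate_liouville_axial hcont hbdd hmild hinv hdecay
      (h₁ hcont hbdd hdiv hmild hinv hdecay)

end Literature.Analysis.FluidPDE

end
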